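import Summits.BirchSwinnertonDyer.BirchSwinnertonDyer.Theorems.GenusKolyvaginAtTwoShaCellHalvingLowerHalf
import Summits.BirchSwinnertonDyer.BirchSwinnertonDyer.Theorems.GenusKolyvaginAtTwoMinimalTwinBSDTwoOddCutDepthZeroFrame
import HarnessLib

/-!
# Route `GenusKolyvaginAtTwo`, crux U₂ `MinimalTwinBSDTwo` (stmt-BirchSwinnertonDyer-22985), LINE 23 «twin_swap» — THE WITNESS-FREE FORM OF THE
# ON-CUT BRANCH: U₂ ⟸ WALL row 1 + PRINT + Q2 + «one odd Heegner budget frame at which the twin's `2^∞`-Selmer group is AS DEEP AS `y_K`»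

Seat `bsd-line-gk2-p2` g32 (PROVER seat 2/3, cell `bsd-f1-sign2`, LINE 23 holder), `--supports stmt-BirchSwinnertonDyer-22985 --as helper`.
THEOREMS ONLY (no definition, no named fact, no `sorry`).  BSD is NOT proved by any of this; U₂ is NOT proved; nothing is closed.

WHAT.  The swapped halving descent B2Q♭⁻± (p813942) replaces LINE 23's Kolyvagin leaf by a SELMER-DEPTH condition on the twin: at a frame of exact
depth `M₀ ≥ 1`, ONE class `s₀ ∈ Sel_(2^M)(W^{(d_K)}/ℚ)` (`M ≥ M₀+1`) of order `≥ 2^{M₀}` (`2^{M₀−1} • s₀ ≠ 0`) PRODUCES the transposition-deep prime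
witness (p814781 `exists_transpositionWitness_of_selmer_twist_class_of_analyticRank_one`); at depth `0` no witness is needed (p812083).  Hence the
WITNESS-FREE census form of the on-cut branch:
* §1 `bsdp_onOddCut_of_selmer_twist_class_of_facts` — `BSD₂(Wd) → BSD₂(W)` on the odd habitat cut at a budget frame of exact depth `M₀ ≥ 1` carrying a
  twin class of order `≥ 2^{M₀}`, modulo Q2 + GZ + GZK + modularity + Milne.
* §2 `minimalTwinBSDTwo_onOddCut_of_wall_of_deepTwinClassFrameSupply_of_facts` — **U₂ on the WHOLE odd habitat cut ⟸ WALL row 1 + PRINT + Q2 +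
  FRAME♭** (per `W`: one odd Heegner frame `≠ ℚ(√−3)` inside the genus budget, an odd-`c` datum, `P(1)` non-torsion with exact depth `M₀`, and EITHER
  `M₀ = 0` OR a class of `Sel_(2^M)(W^{(d_K)}/ℚ)`, `M ≥ M₀+1`, not killed by `2^{M₀−1}`).  By B2Q⁻± (g31) the twin's `2^∞`-Selmer classes are killed by
  `2^{M₀}`, so FRAME♭ says «the twin's Selmer group is EXACTLY as deep as `y_K`» — the `ε = −1`, at-`2` shadow of Kolyvagin's «`m_∞ = m₀ − ord Ш`» with
  one prime.  What is NOT covered: frames where `Ш(W^{(d_K)}/ℚ)[2^∞]` has exponent `< 2^{M₀}` (there Kolyvagin's structure theorem with ≥ 2 primes is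
  needed: LINE 23's WITNESS_{dc,≥2} / LINE 42's STRUCT₂).

HONEST FRAMING.  CONDITIONAL on the displayed hypotheses; FRAME♭ is OPEN (analytic non-vanishing in budget + odd Manin + the Selmer-depth bit); nothing
beyond print is claimed; BSD is NOT proved.

References: [Kolyvagin1989Izv] Thm. B_l, §3; [Kolyvagin1991MathAnn] Thm. 1, Thm. 2.1–2.2; [McCallumLMS1991] §5 Lemma 5.3, Thm. 5.4, Thm. 5.8;
[GrossZagier1986] V.§2 (2.2).
-/

set_option autoImplicit false
set_option linter.dupNamespace false -- `Summit.<P>.<Sub>` repeats `BirchSwinnertonDyer` (D-0017)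

noncomputable section

open scoped Classical

namespace Summit.BirchSwinnertonDyer.BirchSwinnertonDyer.Theorems.GenusExact.TwinSwap.TwinAnnihilation

open Literature.NumberTheory.EllipticCurves Literature.NumberTheory.GaloisRepresentations WeierstrassCurve NumberField
  IsDedekindDomain Field AddSubgroup Literature.NumberTheory.EllipticCurves.ModularForms
open Summit.BirchSwinnertonDyer.Rank1Residual
open Summit.BirchSwinnertonDyer.BirchSwinnertonDyer.Theses.GenusKolyvaginAtTwo (KolyvaginRelationAtTwo)

/-! ## §1 `BSD₂(Wd) → BSD₂(W)` at a frame whose twin carries a class as deep as `y_K` -/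

/-- **`BSD₂(Wd) → BSD₂(W)` on the odd habitat cut at a budget frame of exact depth `M₀ ≥ 1` whose twin carries a `2^M`-Selmer class of order `≥ 2^{M₀}`**
(`M ≥ M₀+1`, `2^{M₀−1} • s₀ ≠ 0`) — NO witness hypothesis: B2Q♭⁻± manufactures the transposition-deep prime (p814781 §1), then p811686 §4.  Modulo
Q2 + GZ + GZK + modularity + Milne.  CONDITIONAL; closes nothing; BSD is NOT proved. [cite: Kolyvagin1989Izv, Thm. B_l, §3] [cite: McCallumLMS1991, §5 Thm. 5.4]
[cite: GrossZagier1986, V.§2 (2.2)] -/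
theorem bsdp_onOddCut_of_selmer_twist_class_of_facts (hQ2 : KolyvaginRelationAtTwo)
    (hGZ : ∀ (N : ℕ) [NeZero N] (W : WeierstrassCurve ℚ) (K : Type) [Field K] [NumberField K], gross_zagier N W K)
    (hGZK : rank_eq_analyticRank_of_analyticRank_le_one) (hmod : hasEntireLFunction_rat)
    (hMilneC : Milne1972.bsdQuotient_baseChange_quadratic_anyModel)
    (W : WeierstrassCurve ℚ) [W.IsElliptic] [W.IsGloballyMinimal] [NeZero (W.conductorNorm ℤ)] (hcm : ¬ W.HasCM)
    (hr : W.analyticRank = 1) (hSel : Nat.card (W.selmerGroup 2) = 2)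
    (hT : Odd W.tamagawaProduct) (v : HeightOneSpectrum (𝓞 ℚ)) (h2v : ((2 : ℕ) : 𝓞 ℚ) ∉ v.asIdeal)
    (hNv : ((W.conductorNorm ℤ : ℕ) : 𝓞 ℚ) ∈ v.asIdeal) (hmult : W.HasMultiplicativeReductionAt v)
    (hρ : ∀ n : ℕ, 0 < n → W.HasSurjectiveModNGaloisRep ((2 : ℤ) ^ n))
    (K : Type) [Field K] [NumberField K] (hK : IsImaginaryQuadratic K) (hodd : Odd (NumberField.discr K))
    (h3 : NumberField.discr K ≠ -3) (hH : SatisfiesHeegnerHypothesis (W.conductorNorm ℤ) K)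
    (Dt : ModularParametrizationData W (W.conductorNorm ℤ)) (hc : Odd Dt.c) (β : ℤ) (ι : K →+* ℂ) (d₁ : KolyvaginHeegnerData Dt β ι 1)
    (hy : ¬ IsOfFinAddOrder d₁.derivedPoint) (M₀ : ℕ)
    (hdiv : ∃ Q : (W.baseChange (ringClassField K ι 1)).toAffine.Point, ((2 ^ M₀ : ℕ) : ℤ) • Q = d₁.derivedPoint)
    (hndiv : ¬ ∃ Q : (W.baseChange (ringClassField K ι 1)).toAffine.Point, ((2 ^ (M₀ + 1) : ℕ) : ℤ) • Q = d₁.derivedPoint)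
    (Wd : WeierstrassCurve ℚ) [Wd.IsElliptic] [Wd.IsGloballyMinimal]
    (hWd : ∃ C : VariableChange ℚ, C • W.quadraticTwist (NumberField.discr K : ℚ) = Wd)
    (hbudget : (W.Δ < 0 ∧ padicValNat 2 Wd.tamagawaProduct ≤ 1) ∨ padicValNat 2 Wd.tamagawaProduct = 0) (hBSDd : BSDp Wd 2)
    [(W.quadraticTwist ((NumberField.discr K : ℤ) : ℚ)).IsElliptic]
    (M : ℕ) (hM₀M : M₀ + 1 ≤ M) (s₀ : galH1Torsion (W.quadraticTwist ((NumberField.discr K : ℤ) : ℚ)) ((2 ^ M : ℕ) : ℤ))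
    (hs₀ : s₀ ∈ selmerGroup (W.quadraticTwist ((NumberField.discr K : ℤ) : ℚ)) ((2 ^ M : ℕ) : ℤ))
    (hne : ((2 ^ (M₀ - 1) : ℕ) : ℤ) • s₀ ≠ 0) :
    BSDp W 2 := by
  obtain ⟨n, d, hn, hdeep, hPn⟩ := exists_transpositionWitness_of_selmer_twist_class_of_analyticRank_one hQ2 W hcm hr hT v h2v hNv hmult K hK
    hodd h3 hH hρ Dt β ι d₁ M₀ hndiv M hM₀M s₀ hs₀ hne
  exact bsdp_onOddCut_of_transpositionWitness_of_facts hQ2 hGZ hGZK hmod hMilneC W hcm hr hSel hT v h2v hNv hmult hρ K hK hodd h3 hH Dt hc β ι d₁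
    hy M₀ hdiv hndiv Wd hWd hbudget hBSDd n d hn hdeep hPn

/-! ## §2 U₂ on the cut from WALL row 1 + PRINT + Q2 + a «twin Selmer as deep as y_K» frame supply -/

/-- **U₂ ON THE WHOLE ODD HABITAT CUT ⟸ WALL row 1 + PRINT + Q2 + FRAME♭-SUPPLY** — the WITNESS-FREE form.  FRAME♭: for every `W` on the cut (non-CM,
`r_an = 1`, `#Sel₂ = 2`, `C(W)` odd, `ρ_{W,2^∞}` onto, an odd multiplicative prime) ONE odd Heegner frame `K ≠ ℚ(√−3)`, an odd-`c` datum, a conductor-`1`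
datum whose `P(1)` has infinite order and exact depth `M₀`, a globally minimal twin model inside the genus budget, and EITHER `M₀ = 0` OR a class of
`Sel_(2^M)(W^{(d_K)}/ℚ)` (`M ≥ M₀+1`) not killed by `2^{M₀−1}`.  Then `BSD₂(W)` on the cut (depth `0`: p812083; depth `≥ 1`: §1; the twin is non-CM of
analytic rank `0`, so S1′ pays `BSD₂(Wd)`).  FRAME♭ is OPEN; CONDITIONAL; closes nothing; BSD is NOT proved.
[cite: Kolyvagin1989Izv, Thm. A, Thm. B_l] [cite: Kolyvagin1991MathAnn, Thm. 1] [cite: GrossZagier1986, V.§2 (2.2)] -/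
theorem minimalTwinBSDTwo_onOddCut_of_wall_of_deepTwinClassFrameSupply_of_facts (hQ2 : KolyvaginRelationAtTwo)
    (hGZ : ∀ (N : ℕ) [NeZero N] (W : WeierstrassCurve ℚ) (K : Type) [Field K] [NumberField K], gross_zagier N W K)
    (hGZK : rank_eq_analyticRank_of_analyticRank_le_one) (hmod : hasEntireLFunction_rat)
    (hMilneC : Milne1972.bsdQuotient_baseChange_quadratic_anyModel)
    (hS1 : ∀ (W : WeierstrassCurve ℚ) [W.IsElliptic] [W.IsGloballyMinimal], ¬ W.HasCM → W.analyticRank = 0 → BSDp W 2)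
    (hSupplyD : ∀ (W : WeierstrassCurve ℚ) [W.IsElliptic] [W.IsGloballyMinimal] [NeZero (W.conductorNorm ℤ)],
      ¬ W.HasCM → W.analyticRank = 1 → Nat.card (W.selmerGroup 2) = 2 → Odd W.tamagawaProduct →
      (∀ n : ℕ, 0 < n → W.HasSurjectiveModNGaloisRep ((2 : ℤ) ^ n)) →
      (∃ v : HeightOneSpectrum (𝓞 ℚ), ((2 : ℕ) : 𝓞 ℚ) ∉ v.asIdeal ∧ ((W.conductorNorm ℤ : ℕ) : 𝓞 ℚ) ∈ v.asIdeal ∧ W.HasMultiplicativeReductionAt v) →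
      ∃ (K : Type) (_ : Field K) (_ : NumberField K), IsImaginaryQuadratic K ∧ Odd (NumberField.discr K) ∧ NumberField.discr K ≠ -3 ∧
        SatisfiesHeegnerHypothesis (W.conductorNorm ℤ) K ∧
        ∃ (Dt : ModularParametrizationData W (W.conductorNorm ℤ)) (β : ℤ) (ι : K →+* ℂ) (d₁ : KolyvaginHeegnerData Dt β ι 1) (M₀ : ℕ),
          Odd Dt.c ∧ ¬ IsOfFinAddOrder d₁.derivedPoint ∧
          (∃ Q : (W.baseChange (ringClassField K ι 1)).toAffine.Point, ((2 ^ M₀ : ℕ) : ℤ) • Q = d₁.derivedPoint) ∧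
          (¬ ∃ Q : (W.baseChange (ringClassField K ι 1)).toAffine.Point, ((2 ^ (M₀ + 1) : ℕ) : ℤ) • Q = d₁.derivedPoint) ∧
          (∃ (Wd : WeierstrassCurve ℚ) (_ : Wd.IsElliptic) (_ : Wd.IsGloballyMinimal),
            (∃ C : VariableChange ℚ, C • W.quadraticTwist (NumberField.discr K : ℚ) = Wd) ∧
              ((W.Δ < 0 ∧ padicValNat 2 Wd.tamagawaProduct ≤ 1) ∨ padicValNat 2 Wd.tamagawaProduct = 0)) ∧
          (M₀ = 0 ∨ ∃ (_ : (W.quadraticTwist ((NumberField.discr K : ℤ) : ℚ)).IsElliptic) (M : ℕ)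
            (s₀ : galH1Torsion (W.quadraticTwist ((NumberField.discr K : ℤ) : ℚ)) ((2 ^ M : ℕ) : ℤ)),
            M₀ + 1 ≤ M ∧ s₀ ∈ selmerGroup (W.quadraticTwist ((NumberField.discr K : ℤ) : ℚ)) ((2 ^ M : ℕ) : ℤ) ∧ ((2 ^ (M₀ - 1) : ℕ) : ℤ) • s₀ ≠ 0)) :
    ∀ (W : WeierstrassCurve ℚ) [W.IsElliptic] [W.IsGloballyMinimal] [NeZero (W.conductorNorm ℤ)],
      ¬ W.HasCM → W.analyticRank = 1 → Nat.card (W.selmerGroup 2) = 2 → Odd W.tamagawaProduct →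
      (∀ n : ℕ, 0 < n → W.HasSurjectiveModNGaloisRep ((2 : ℤ) ^ n)) →
      (∃ v : HeightOneSpectrum (𝓞 ℚ), ((2 : ℕ) : 𝓞 ℚ) ∉ v.asIdeal ∧ ((W.conductorNorm ℤ : ℕ) : 𝓞 ℚ) ∈ v.asIdeal ∧ W.HasMultiplicativeReductionAt v) →
      BSDp W 2 := by
  intro W _ _ _ hcm hr hSel hT hρ hv
  obtain ⟨K, iF, iN, hK, hodd, h3, hH, Dt, β, ι, d₁, M₀, hc, hy, hdiv, hndiv, ⟨Wd, iE, iM, ⟨Cd, hCd⟩, hbudget⟩, hdeepTw⟩ :=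
    hSupplyD W hcm hr hSel hT hρ hv
  obtain ⟨v, h2v, hNv, hmult⟩ := hv
  -- the twin model is non-CM (same `j`) of analytic rank `0` (Gross–Zagier), so `BSD₂(Wd)` by S1′
  have hD0 : (NumberField.discr K : ℚ) ≠ 0 := by exact_mod_cast NumberField.discr_ne_zero K
  haveI hTell : (W.quadraticTwist (NumberField.discr K : ℚ)).IsElliptic := W.isElliptic_quadraticTwist hD0
  obtain ⟨Ph, hPh, hPhmap⟩ := AdditiveKoly.exists_isHeegnerPoint_map_eq_derivedPoint_one (W := W) (K := K) (Dt := Dt) (β := β)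
    (ι := ι) hK hH d₁
  have hPinf : ¬ IsOfFinAddOrder Ph := by
    intro hfin
    apply hy
    rw [← hPhmap]
    exact (WeierstrassCurve.Affine.Point.map (W' := W) (algebraMap K (ringClassField K ι 1)).toRatAlgHom).isOfFinAddOrder hfin
  have hrT : (W.quadraticTwist (NumberField.discr K : ℚ)).analyticRank = 0 :=
    analyticRank_twist_eq_zero_of_rankOne W K (hGZ _ W K) hmod hK hH hr hPh hPinf
  subst hCd
  have hcmd : ¬ (Cd • W.quadraticTwist (NumberField.discr K : ℚ)).HasCM := by
    rw [hasCM_iff_of_j_eq (((W.quadraticTwist (NumberField.discr K : ℚ)).variableChange_j Cd).trans (W.j_quadraticTwist hD0))]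
    exact hcm
  have hrd : (Cd • W.quadraticTwist (NumberField.discr K : ℚ)).analyticRank = 0 := by
    rw [analyticRank_smul]
    exact hrT
  have hBSDd : BSDp (Cd • W.quadraticTwist (NumberField.discr K : ℚ)) 2 := hS1 _ hcmd hrd
  rcases hdeepTw with h0 | ⟨iT, M, s₀, hM₀M, hs₀, hne⟩
  · -- depth 0: the frame itself is the witness (p812083)
    subst h0
    have hndiv' : ¬ ∃ Q : (W.baseChange (ringClassField K ι 1)).toAffine.Point, (2 : ℤ) • Q = d₁.derivedPoint := by
      simpa using hndiv
    exact bsdp_onOddCut_of_depthZeroFrame_of_facts hQ2 hGZ hGZK hmod hMilneC W hcm hr hSel hT v h2v hNv hmult hρ K hK hodd h3 hH Dt hc β ι d₁ hy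
      hndiv' (Cd • W.quadraticTwist (NumberField.discr K : ℚ)) ⟨Cd, rfl⟩ hbudget hBSDd
  · -- depth ≥ 1: the halving descent manufactures the witness (§1)
    exact bsdp_onOddCut_of_selmer_twist_class_of_facts hQ2 hGZ hGZK hmod hMilneC W hcm hr hSel hT v h2v hNv hmult hρ K hK hodd h3 hH Dt hc β ι d₁
      hy M₀ hdiv hndiv (Cd • W.quadraticTwist (NumberField.discr K : ℚ)) ⟨Cd, rfl⟩ hbudget hBSDd M hM₀M s₀ hs₀ hne

end Summit.BirchSwinnertonDyer.BirchSwinnertonDyer.Theorems.GenusExact.TwinSwap.TwinAnnihilation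

end
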